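import Mathlib
import Summits.Schanuel.Schanuel.Theses.RigidCore
import Summits.Schanuel.Schanuel.Theorems.RigidCoreMinimalCounterexampleInAclCellSelectors

/-!
# THE DEFINABLE-PATTERN CLASS SELECTOR — arithmetic isolation, selector half
# (crux stmt-Schanuel-0969 `RigidCore.MinimalCounterexampleInAcl`)

Line `kernel-arithmetic-selection` (lead prover-line-stmt-Schanuel-0969-c12-0), `--supports stmt-Schanuel-0969`; infrastructure for the
registered stub `stub_geThree` (= item stmt-Schanuel-14744, (S*) in the ranks `n ≥ 3`) on its CORANK-ONE sector.

The landed `finiteClassSelector` (Theorems/…CellSelectors) isolates a point `u` of an `∅`-definable `V ⊆ ℂ^m` lying on finitely many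
cosets of `(2πiℤ)^m` by its EXACT HIT PATTERN `H = {κ ∈ ℤ^m : u + 2πiκ ∈ V}` when `H` is finite: a finite pattern is a list of numerals,
hence nameable by an `∅`-formula.  This file removes finiteness: the same selector works for ANY hit pattern whose copy
`{(κ_k)_k : κ ∈ H} ⊆ ℂ^m` is `∅`-definable in `ℂ_exp` and which has no period (`H + μ = H ⇒ μ = 0`):

* `definable_patternSet_of_definable` — for `∅`-definable `V, Hc ⊆ ℂ^m`, the set of `v` such that for some kernel generator
  `t ∈ {±2πi}` the integer vectors `w` with `v + t·w ∈ V` are EXACTLY the points of `Hc` is `∅`-definable (`ℤ` is `∅`-definable, KMO 2012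
  §2.2, so "for all integer vectors" is a first-order quantifier);
* `definableClassSelector` — if moreover `{exp ∘ v : v ∈ V}` is finite, `u ∈ V`, `Hc` is the copy of `u`'s hit pattern and the pattern is
  aperiodic, then every `u_k ∈ acl^{ℂ_exp}(∅)` (the pattern set contains `u`, lies in `V`, and meets each coset-and-sign class in at most one
  point, so it is finite);
* `aperiodic_of_noFullLine` — aperiodicity follows from "no full line": if for every `μ ≠ 0` some `u + 2πijμ` (`j ∈ ℤ`) misses `V`, the
  pattern of `u ∈ V` has no period (a period `μ` would put every `jμ` in the pattern, by induction from `0`);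
* `intCombos_mem_expAcl_of_definablePattern`, `mem_expAcl_of_corankOne_definablePattern` — **(S*) ON THE CORANK-ONE MIXED SECTOR OF EVERY
  RANK follows from [the hit pattern of `x` in the joint value set is `∅`-definable in `ℂ_exp`] ∧ [no full line of mates]**, by the selector,
  the landed bridge (`valueTuples_definable`, `cexp_image_valueTuples_finite`) and the acl-field criterion `firstFailure_mem_expAcl_of_intCombos`.

WHY THIS MATTERS (status note `Cruxes/MinimalCounterexampleInAcl/Lines/kernel_arithmetic_selection.md` §Addendum c12).  A first failure `x`
is an isolated point of `V_x ∩ Γ_exp` with `V_x` defined over ℚ, so its coordinates are COMPUTABLE complex numbers and its hit pattern is an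
ARITHMETICAL subset of `ℤ^m`; arithmetical sets are `∅`-definable in `ℂ_exp` because `ℤ` with its ring operations is (`intSet`; transfer
lemma in the sibling file …ArithmeticTransfer).  So on the corank-one sector the only analytic input left is "no full line", and the
"no selector beats a two-sided recurrent family" heuristic of the earlier audits (a selector as a Borel transversal of an irrational
rotation) does not apply: it quantified over all phases, while the crux needs a formula for ONE, computable, phase.

References: [KirbyMacintyreOnshuus2012] J. Kirby, A. Macintyre, A. Onshuus, *The algebraic numbers definable in various exponential
fields*, J. Inst. Math. Jussieu 11 (2012), arXiv:1101.4224, §2 (`ℤ` and `±2πi` are `∅`-definable in `ℂ_exp`); [Marker2002] D. Marker,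
*Model Theory: An Introduction*, GTM 217, §1.3 (`acl`); [Kirby2010] J. Kirby, *Exponential algebraicity in exponential fields*,
Bull. LMS 42 (2010), arXiv:0810.4285, Prop. 7.2.
-/

noncomputable section

set_option linter.dupNamespace false

open Complex Set FirstOrder

namespace Summit.Schanuel.Schanuel.Cruxes.MinimalCounterexampleInAcl.KernelArithmeticSelection

open Literature.NumberTheory.Transcendental (SchanuelRank)
open Literature.ModelTheory.ExponentialFields
open Summit.Schanuel.Schanuel.Theorems.AclSubsetLogFreeCore.Negative

variable {n m : ℕ}

/-! ## The exact-pattern set with a definable pattern -/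

/-- **Definability of the exact-pattern set, definable pattern.**  For `∅`-definable `V, Hc ⊆ ℂ^m`, the set of `v` such that for some
kernel generator `t ∈ {±2πi}` the integer vectors `w` with `v + t·w ∈ V` are exactly the points of `Hc` is `∅`-definable in `ℂ_exp`
(`ℤ = intSet` and `{±2πi} = kerGenSet` are `∅`-definable, KMO 2012 §2; the universal quantifier over integer vectors is a block of `m` bound
variables). [cite: KirbyMacintyreOnshuus2012, §2] -/
theorem definable_patternSet_of_definable {V : Set (Fin m → ℂ)} (hV : (∅ : Set ℂ).Definable Language.expRing V)
    {Hc : Set (Fin m → ℂ)} (hHc : (∅ : Set ℂ).Definable Language.expRing Hc) :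
    (∅ : Set ℂ).Definable Language.expRing
      {v : Fin m → ℂ | ∃ t : ℂ, t ∈ kerGenSet ∧
        ∀ w : Fin m → ℂ, (∀ k, w k ∈ intSet) → ((fun k => v k + t * w k) ∈ V ↔ w ∈ Hc)} := by
  classical
  refine definable_setOf_exists_params (definable_setOf_and_params ?_ ?_)
  · exact definable_mem_kerGenSet (definableFun_proj_params _)
  · have hZ : (∅ : Set ℂ).Definable Language.expRing
        {z : (Fin m ⊕ Unit) ⊕ Fin m → ℂ | (∀ k, z (Sum.inr k) ∈ intSet) →
          ((fun k => z (Sum.inl (Sum.inl k)) + z (Sum.inl (Sum.inr ())) * z (Sum.inr k)) ∈ V ↔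
            (fun k => z (Sum.inr k)) ∈ Hc)} := by
      refine definable_setOf_imp_params ?_ ?_
      · rw [Set.setOf_forall]
        exact Set.definable_iInter_of_finite fun k => definable_mem_intSet (definableFun_proj_params _)
      · have hP : (∅ : Set ℂ).Definable Language.expRing {z : (Fin m ⊕ Unit) ⊕ Fin m → ℂ |
            (fun k => z (Sum.inl (Sum.inl k)) + z (Sum.inl (Sum.inr ())) * z (Sum.inr k)) ∈ V} := by
          have hF : (∅ : Set ℂ).DefinableMap Language.expRing
              (fun (z : (Fin m ⊕ Unit) ⊕ Fin m → ℂ) (k : Fin m) =>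
                z (Sum.inl (Sum.inl k)) + z (Sum.inl (Sum.inr ())) * z (Sum.inr k)) := fun k =>
            definableFun_add' (definableFun_proj_params _)
              (definableFun_mul' (definableFun_proj_params _) (definableFun_proj_params _))
          exact hV.preimage_map hF
        have hQ : (∅ : Set ℂ).Definable Language.expRing {z : (Fin m ⊕ Unit) ⊕ Fin m → ℂ |
            (fun k => z (Sum.inr k)) ∈ Hc} := by
          have hF : (∅ : Set ℂ).DefinableMap Language.expRing
              (fun (z : (Fin m ⊕ Unit) ⊕ Fin m → ℂ) (k : Fin m) => z (Sum.inr k)) := fun k =>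
            definableFun_proj_params _
          exact hHc.preimage_map hF
        have h := (definable_setOf_imp_params hP hQ).inter (definable_setOf_imp_params hQ hP)
        convert h using 1
        ext z
        simp only [Set.mem_setOf_eq, Set.mem_inter_iff]
        exact iff_iff_implies_and_implies
    have h := hZ.forall_of_finite
    convert h using 1
    ext w
    simp only [Set.mem_setOf_eq, Sum.elim_inl, Sum.elim_inr]

/-! ## The definable-class selector -/

/-- Injectivity core with an arbitrary (possibly infinite) pattern: if the exact hit patterns of `v` and of `v + t·μ` w.r.t. `t ≠ 0` are
both the pattern `P ⊆ ℤ^m`, then `μ` is a period of `P`. [folklore] -/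
theorem pattern_translate_period {V : Set (Fin m → ℂ)} {t : ℂ} {P : Set (Fin m → ℤ)} {v : Fin m → ℂ} (μ : Fin m → ℤ)
    (hv : ∀ κ : Fin m → ℤ, (fun k => v k + t * (κ k : ℂ)) ∈ V ↔ κ ∈ P)
    (hv' : ∀ κ : Fin m → ℤ, (fun k => (v k + t * (μ k : ℂ)) + t * (κ k : ℂ)) ∈ V ↔ κ ∈ P) :
    ∀ κ : Fin m → ℤ, κ ∈ P ↔ μ + κ ∈ P := by
  intro κ
  rw [← hv' κ, ← hv (μ + κ)]
  have e : (fun k => (v k + t * (μ k : ℂ)) + t * (κ k : ℂ)) = fun k => v k + t * ((μ + κ : Fin m → ℤ) k : ℂ) := by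
    funext k; simp only [Pi.add_apply, Int.cast_add]; ring
  rw [e]

/-- **THE DEFINABLE-CLASS SELECTOR.**  Let `V ⊆ ℂ^m` be `∅`-definable in `ℂ_exp` with `{exp ∘ v : v ∈ V}` finite (so `V` lies on finitely
many cosets of `(2πiℤ)^m`) and `u ∈ V`.  Suppose the copy in `ℂ^m` of the hit pattern `H = {κ ∈ ℤ^m : u + 2πiκ ∈ V}` is `∅`-definable in
`ℂ_exp` and `H` is APERIODIC (`H = H − μ ⇒ μ = 0`).  Then every `u_k ∈ acl^{ℂ_exp}(∅)`: the exact-pattern set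
(`definable_patternSet_of_definable`) contains `u`, lies in `V` (as `0 ∈ H`), and two of its points with the same exponentials and the same
sign differ by a period of `H` (`pattern_translate_period`), so it is finite.  With `H` finite this is `finiteClassSelector`.
[cite: KirbyMacintyreOnshuus2012, §2] -/
theorem definableClassSelector {V : Set (Fin m → ℂ)} (hV : (∅ : Set ℂ).Definable Language.expRing V)
    (hVfin : ((fun v : Fin m → ℂ => cexp ∘ v) '' V).Finite) {u : Fin m → ℂ} (hu : u ∈ V)
    (hHdef : (∅ : Set ℂ).Definable Language.expRing
      {w : Fin m → ℂ | ∃ κ : Fin m → ℤ, (∀ k, w k = (κ k : ℂ)) ∧ (fun k => u k + 2 * ↑Real.pi * I * (κ k : ℂ)) ∈ V})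
    (haper : ∀ μ : Fin m → ℤ,
      (∀ κ : Fin m → ℤ, (fun k => u k + 2 * ↑Real.pi * I * (κ k : ℂ)) ∈ V ↔
        (fun k => u k + 2 * ↑Real.pi * I * ((μ + κ : Fin m → ℤ) k : ℂ)) ∈ V) → μ = 0) :
    ∀ k, u k ∈ expAcl := by
  classical
  intro k
  -- name the definable copy `Hc` of the pattern and the abstract pattern `P`
  generalize hHc : {w : Fin m → ℂ | ∃ κ : Fin m → ℤ, (∀ k, w k = (κ k : ℂ)) ∧
      (fun k => u k + 2 * ↑Real.pi * I * (κ k : ℂ)) ∈ V} = Hc at hHdef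
  obtain ⟨P, hP⟩ : ∃ P : Set (Fin m → ℤ), ∀ κ : Fin m → ℤ,
      κ ∈ P ↔ (fun k => u k + 2 * ↑Real.pi * I * (κ k : ℂ)) ∈ V := ⟨_, fun _ => Iff.rfl⟩
  have hmemHc : ∀ κ : Fin m → ℤ, (fun k => (κ k : ℂ)) ∈ Hc ↔ κ ∈ P := by
    intro κ
    rw [hP, ← hHc]
    constructor
    · rintro ⟨κ', hκ', hV'⟩
      have : κ = κ' := funext fun k => by
        have h : ((κ k : ℤ) : ℂ) = (κ' k : ℂ) := hκ' k
        exact_mod_cast h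
      subst this; exact hV'
    · intro h; exact ⟨κ, fun _ => rfl, h⟩
  have h0 : (0 : Fin m → ℤ) ∈ P := by
    rw [hP]
    have e : (fun k => u k + 2 * ↑Real.pi * I * ((0 : Fin m → ℤ) k : ℂ)) = u := by
      funext k; simp
    rw [e]; exact hu
  -- the pattern predicate for a generator `t`: the exact integer pattern of `v` w.r.t. `t` is `Hc`
  obtain ⟨Pat, hPat⟩ : ∃ Pat : ℂ → (Fin m → ℂ) → Prop, ∀ t v, Pat t v ↔
      ∀ w : Fin m → ℂ, (∀ k, w k ∈ intSet) → ((fun k => v k + t * w k) ∈ V ↔ w ∈ Hc) := ⟨_, fun _ _ => Iff.rfl⟩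
  have hPat_iff : ∀ (t : ℂ) (v : Fin m → ℂ), Pat t v →
      ∀ κ : Fin m → ℤ, (fun k => v k + t * (κ k : ℂ)) ∈ V ↔ κ ∈ P := by
    intro t v hv κ
    rw [← hmemHc]
    exact (hPat t v).1 hv (fun k => (κ k : ℂ)) (fun k => mem_intSet_iff.2 ⟨κ k, rfl⟩)
  -- `u` has pattern `Hc` w.r.t. `t = 2πi`
  have huPat : Pat (2 * ↑Real.pi * I) u := by
    refine (hPat _ _).2 fun w hw => ?_
    choose κ hκ using fun k => mem_intSet_iff.1 (hw k)
    have ew : w = fun k => (κ k : ℂ) := funext hκ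
    subst ew
    rw [hmemHc, hP]
  -- the selector set
  have hTdef : (∅ : Set ℂ).Definable Language.expRing {v : Fin m → ℂ | ∃ t : ℂ, t ∈ kerGenSet ∧ Pat t v} := by
    have h := definable_patternSet_of_definable hV hHdef
    convert h using 2 with v
    simp only [hPat]
  have huT : u ∈ {v : Fin m → ℂ | ∃ t : ℂ, t ∈ kerGenSet ∧ Pat t v} :=
    ⟨2 * ↑Real.pi * I, mem_kerGenSet_iff.2 (Or.inl rfl), huPat⟩
  -- finiteness: on each sign, the pattern set lies in `V` and `exp ∘ ·` is injective on it
  have hTt : ∀ t : ℂ, t ∈ kerGenSet → Set.Finite {v | Pat t v} := by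
    intro t ht
    have hsub : {v | Pat t v} ⊆ V := by
      intro v hv
      have h := (hPat_iff t v hv 0).2 h0
      have e : (fun k => v k + t * ((0 : Fin m → ℤ) k : ℂ)) = v := by
        funext k; simp
      rwa [e] at h
    refine Set.Finite.of_finite_image (hVfin.subset (Set.image_mono hsub)) ?_
    intro v hv v' hv' hvv'
    obtain ⟨μ, rfl⟩ := exists_int_translate_of_cexp_eq ht hvv'.symm
    have hper : ∀ κ : Fin m → ℤ, κ ∈ P ↔ μ + κ ∈ P :=
      pattern_translate_period (V := V) (t := t) μ (hPat_iff t v hv) (hPat_iff t _ hv')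
    have hμ : μ = 0 := by
      refine haper μ fun κ => ?_
      rw [← hP, ← hP]
      exact hper κ
    subst hμ
    funext k; simp
  have hTfin : Set.Finite {v : Fin m → ℂ | ∃ t : ℂ, t ∈ kerGenSet ∧ Pat t v} := by
    have hcover : {v : Fin m → ℂ | ∃ t : ℂ, t ∈ kerGenSet ∧ Pat t v} ⊆
        {v | Pat (2 * ↑Real.pi * I) v} ∪ {v | Pat (-(2 * ↑Real.pi * I)) v} := by
      rintro v ⟨t, ht, hv⟩
      rcases mem_kerGenSet_iff.1 ht with rfl | rfl
      · exact Or.inl hv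
      · exact Or.inr hv
    exact ((hTt _ (mem_kerGenSet_iff.2 (Or.inl rfl))).union (hTt _ (mem_kerGenSet_iff.2 (Or.inr rfl)))).subset hcover
  exact coord_mem_expAcl hTfin hTdef huT k

/-- **Aperiodicity from "no full line".**  If `u ∈ V` and for every non-zero integer direction `μ` some kernel translate `u + 2πi·jμ`
(`j ∈ ℤ`) misses `V`, then the hit pattern of `u` has no period: a period `μ ≠ 0` would put `jμ` in the pattern for every `j ∈ ℤ`
(induction up and down from `0`). [folklore] -/
theorem aperiodic_of_noFullLine {V : Set (Fin m → ℂ)} {u : Fin m → ℂ} (hu : u ∈ V)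
    (hno : ∀ μ : Fin m → ℤ, μ ≠ 0 → ∃ j : ℤ, (fun k => u k + 2 * ↑Real.pi * I * ((j • μ : Fin m → ℤ) k : ℂ)) ∉ V) :
    ∀ μ : Fin m → ℤ,
      (∀ κ : Fin m → ℤ, (fun k => u k + 2 * ↑Real.pi * I * (κ k : ℂ)) ∈ V ↔
        (fun k => u k + 2 * ↑Real.pi * I * ((μ + κ : Fin m → ℤ) k : ℂ)) ∈ V) → μ = 0 := by
  intro μ hper
  by_contra hμ
  obtain ⟨j, hj⟩ := hno μ hμ
  apply hj
  -- every integer multiple of the period is a hit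
  set P : ℤ → Prop := fun j => (fun k => u k + 2 * ↑Real.pi * I * ((j • μ : Fin m → ℤ) k : ℂ)) ∈ V with hP
  have h0 : P 0 := by simp only [hP, zero_smul, Pi.zero_apply, Int.cast_zero, mul_zero, add_zero]; exact hu
  have hstep : ∀ j : ℤ, P j ↔ P (j + 1) := by
    intro j
    have h := hper (j • μ)
    have e : μ + j • μ = (j + 1) • μ := by rw [add_smul, one_smul, add_comm]
    rw [e] at h
    exact h
  have hall : ∀ j : ℤ, P j := fun j =>
    Int.induction_on j h0 (fun i ih => (hstep i).1 ih) fun i ih => by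
      have h := (hstep (-(i : ℤ) - 1)).2
      rw [sub_add_cancel] at h
      exact h ih
  exact hall j

/-! ## The corank-one mixed sector from a DEFINABLE HIT PATTERN, every rank -/

/-- **Joint values with an `∅`-definable aperiodic hit pattern are in `acl(∅)` (every rank, any number of mixed directions).**  For a
ℚ-linearly independent `x` and integer directions `M_k` with `e^{M_k·x}` algebraic: if the copy in `ℂ^m` of the hit pattern of
`u = (M_k·x)_k` in the joint value set `V = {(M_k·x')_k : x' mate}` is `∅`-definable in `ℂ_exp` and no non-zero integer direction carries a
full line of hits through `u`, then every `M_k·x ∈ acl^{ℂ_exp}(∅)` (`definableClassSelector` on the landed bridge). [cite: KirbyMacintyreOnshuus2012, §2] -/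
theorem intCombos_mem_expAcl_of_definablePattern {x : Fin n → ℂ} (hx : LinearIndependent ℚ x) (M : Fin m → Fin n → ℤ)
    (halg : ∀ k, IsAlgebraic ℚ (cexp (∑ i, (M k i : ℂ) * x i)))
    (hHdef : (∅ : Set ℂ).Definable Language.expRing
      {w : Fin m → ℂ | ∃ κ : Fin m → ℤ, (∀ k, w k = (κ k : ℂ)) ∧
        (fun k => (∑ i, (M k i : ℂ) * x i) + 2 * ↑Real.pi * I * (κ k : ℂ)) ∈
          {v : Fin m → ℂ | ∃ x' ∈ locusMates x, ∀ k, v k = ∑ i, (M k i : ℂ) * x' i}})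
    (hno : ∀ μ : Fin m → ℤ, μ ≠ 0 → ∃ j : ℤ,
      (fun k => (∑ i, (M k i : ℂ) * x i) + 2 * ↑Real.pi * I * ((j • μ : Fin m → ℤ) k : ℂ)) ∉
        {v : Fin m → ℂ | ∃ x' ∈ locusMates x, ∀ k, v k = ∑ i, (M k i : ℂ) * x' i}) :
    ∀ k, (∑ i, (M k i : ℂ) * x i) ∈ expAcl := by
  set V : Set (Fin m → ℂ) := {v : Fin m → ℂ | ∃ x' ∈ locusMates x, ∀ k, v k = ∑ i, (M k i : ℂ) * x' i} with hV
  set u : Fin m → ℂ := fun k => ∑ i, (M k i : ℂ) * x i with hu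
  have hVdef : (∅ : Set ℂ).Definable Language.expRing V := valueTuples_definable x M
  have hVfin : ((fun v : Fin m → ℂ => cexp ∘ v) '' V).Finite := cexp_image_valueTuples_finite x M halg
  have huV : u ∈ V := self_mem_valueTuples hx M
  exact definableClassSelector hVdef hVfin huV hHdef (aperiodic_of_noFullLine huV hno)

/-- **(S*) ON THE CORANK-ONE MIXED SECTOR OF EVERY RANK FOLLOWS FROM [DEFINABLE HIT PATTERN] ∧ [NO FULL LINE].**  At a first failure `x` of
rank `n = m + 1` with `m` ℚ-independent mixed directions `M_k` (`e^{M_k·x} ∈ ℚ̄`): if the copy of the hit pattern of `(M_k·x)_k` in the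
joint value set is `∅`-definable in `ℂ_exp` and no non-zero integer direction carries a full line of hits, then every coordinate of `x` lies
in `acl^{ℂ_exp}(∅)` (`intCombos_mem_expAcl_of_definablePattern` and the acl-field criterion `firstFailure_mem_expAcl_of_intCombos`, which
uses `SchanuelRank (n − 1)`).  The first hypothesis holds for every first failure in mathematics (the pattern is arithmetical: `x` is a
computable point) — its formalisation is computable analysis inside first-order arithmetic; the second is the analytic residue of the sector.
[cite: Kirby2010, Prop. 7.2] -/
theorem mem_expAcl_of_corankOne_definablePattern {x : Fin n → ℂ} (hx : x ∈ firstFailures n) (hmn : n = m + 1)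
    (M : Fin m → Fin n → ℤ) (hli : LinearIndependent ℚ (fun k => ∑ i, (M k i : ℂ) * x i))
    (halg : ∀ k, IsAlgebraic ℚ (cexp (∑ i, (M k i : ℂ) * x i)))
    (hHdef : (∅ : Set ℂ).Definable Language.expRing
      {w : Fin m → ℂ | ∃ κ : Fin m → ℤ, (∀ k, w k = (κ k : ℂ)) ∧
        (fun k => (∑ i, (M k i : ℂ) * x i) + 2 * ↑Real.pi * I * (κ k : ℂ)) ∈
          {v : Fin m → ℂ | ∃ x' ∈ locusMates x, ∀ k, v k = ∑ i, (M k i : ℂ) * x' i}})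
    (hno : ∀ μ : Fin m → ℤ, μ ≠ 0 → ∃ j : ℤ,
      (fun k => (∑ i, (M k i : ℂ) * x i) + 2 * ↑Real.pi * I * ((j • μ : Fin m → ℤ) k : ℂ)) ∉
        {v : Fin m → ℂ | ∃ x' ∈ locusMates x, ∀ k, v k = ∑ i, (M k i : ℂ) * x' i}) :
    ∀ i, x i ∈ expAcl :=
  firstFailure_mem_expAcl_of_intCombos hx hmn M hli (intCombos_mem_expAcl_of_definablePattern hx.1 M halg hHdef hno)

/-! ## Registered form (explicit binders, fully qualified; `ledger workitem stub-add stmt-Schanuel-0969 --name stub_corankOne_definablePattern …`) -/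

/-- Registered form of `mem_expAcl_of_corankOne_definablePattern` (stub `stub_corankOne_definablePattern` of crux stmt-Schanuel-0969, line
kernel-arithmetic-selection, lead c12): (S*) on the corank-one mixed sector of every rank from [definable hit pattern] ∧ [no full line]. -/
theorem stub_corankOne_definablePattern : ∀ (n m : ℕ) (x : Fin n → ℂ), x ∈ Summit.Schanuel.Schanuel.Cruxes.MinimalCounterexampleInAcl.KernelArithmeticSelection.firstFailures n → n = m + 1 → ∀ (M : Fin m → Fin n → ℤ), LinearIndependent ℚ (fun k => ∑ i, (M k i : ℂ) * x i) → (∀ k, IsAlgebraic ℚ (Complex.exp (∑ i, (M k i : ℂ) * x i))) → (∅ : Set ℂ).Definable Literature.ModelTheory.ExponentialFields.Language.expRing {w : Fin m → ℂ | ∃ κ : Fin m → ℤ, (∀ k, w k = (κ k : ℂ)) ∧ (fun k => (∑ i, (M k i : ℂ) * x i) + 2 * ↑Real.pi * Complex.I * (κ k : ℂ)) ∈ {v : Fin m → ℂ | ∃ x' ∈ Summit.Schanuel.Schanuel.Cruxes.MinimalCounterexampleInAcl.KernelArithmeticSelection.locusMates x, ∀ k, v k = ∑ i, (M k i : ℂ)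 * x' i}} → (∀ μ : Fin m → ℤ, μ ≠ 0 → ∃ j : ℤ, (fun k => (∑ i, (M k i : ℂ) * x i) + 2 * ↑Real.pi * Complex.I * ((j • μ : Fin m → ℤ) k : ℂ)) ∉ {v : Fin m → ℂ | ∃ x' ∈ Summit.Schanuel.Schanuel.Cruxes.MinimalCounterexampleInAcl.KernelArithmeticSelection.locusMates x, ∀ k, v k = ∑ i, (M k i : ℂ) * x' i}) → ∀ i, x i ∈ Summit.Schanuel.Schanuel.Theorems.AclSubsetLogFreeCore.Negative.expAcl :=
  fun _ _ _ hx hmn M hli halg hHdef hno => mem_expAcl_of_corankOne_definablePattern hx hmn M hli halg hHdef hno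

end Summit.Schanuel.Schanuel.Cruxes.MinimalCounterexampleInAcl.KernelArithmeticSelection

end
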